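import Summits.MatrixMultiplication.MatrixMultiplication.Theorems.AbelianSTPPCensusShapeCertVQDefs

/-!
# Abelian STPP census — kernel evaluation of the vQ certificate checker `ShapeCertVQ` (F: orders 355–356)

Cell mm-stpp, rung F-M1; successor kernel item VQ-CERT (T_E beyond 337 under vQ := vP ∧ E3⁺) in support of the closed crux item
stmt-MatrixMultiplication-19191; seat mm-stpp-vp-p2 (gen 1); support file (no definitions).  `ShapeCertVQ.checkQ M = true` by
`decide +kernel` (no `native_decide`, standard axioms), ONE theorem per order so that every kernel evaluation starts with empty
caches; `Elab.async false` keeps the evaluations sequential (one kernel computation in memory at a time; precedent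
`…ShapeCertVPEvalA`).  Measured in the seat folder (Lean `#eval` of the same search / kernel wall): 355, 356 —
candidate visits `2.0–2.6·10⁴` per order, kernel ≈ `40–160 s` per order.  The range lemma
`checkQ_355_356` collects the file; soundness `ShapeCertVQ.checkQ_sound` (`…ShapeCertVQSearch`) and the bridge
`ShapeCertVQ.shapeExclusionVQ_of_checkQ` (`…ShapeCertVQFinal`) turn it into the vQ shape exclusion, assembled in the leaf file.
WHAT THIS IS NOT: a Boolean evaluation; no statement about STPP families or `ω` by itself.
-/

set_option linter.dupNamespace false -- `MatrixMultiplication.MatrixMultiplication` (summit = problem, D-0017)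
set_option autoImplicit false
set_option Elab.async false -- sequential kernel evaluations (memory high-water of one order at a time)

namespace Summit.MatrixMultiplication.MatrixMultiplication.Theorems.ShapeCertVQ

set_option maxHeartbeats 0 in
/-- vQ certificate check at order `355` (kernel evaluation) -/
theorem checkQ_355 : checkQ 355 = true := by
  decide +kernel

set_option maxHeartbeats 0 in
/-- vQ certificate check at order `356` (kernel evaluation) -/
theorem checkQ_356 : checkQ 356 = true := by
  decide +kernel

/-- **the vQ certificate holds at every order `355 ≤ M ≤ 356`** -/
theorem checkQ_355_356 (M : ℕ) (h₁ : 355 ≤ M) (h₂ : M ≤ 356) : checkQ M = true := by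
  interval_cases M
  · exact checkQ_355
  · exact checkQ_356

end Summit.MatrixMultiplication.MatrixMultiplication.Theorems.ShapeCertVQ
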